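import Summits.Ventures.QEC.Census.CertCheckBZSound
import Summits.Ventures.QEC.Census.CertBZInfoSets
import Summits.Ventures.QEC.Census.BB.BB90.BZStructZ
import Summits.Ventures.QEC.Census.BB.BB90.BZInfoSetsZ1
import Summits.Ventures.QEC.Census.BB.BB90.BZBoundsZ
import Summits.Ventures.QEC.Census.BB.BB90.BZEnumZ01
import Summits.Ventures.QEC.Census.BB.BB90.BZEnumZ02
import Summits.Ventures.QEC.Census.BB.BB90.BZEnumZ03
import Summits.Ventures.QEC.Census.BB.BB90.BZEnumZ04
import Summits.Ventures.QEC.Census.BB.BB90.BZEnumZ05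
import Summits.Ventures.QEC.Census.BB.BB90.BZEnumZ06
import Summits.Ventures.QEC.Census.BB.BB90.BZEnumZ07
import Summits.Ventures.QEC.Census.BB.BB90.BZEnumZ08
import Summits.Ventures.QEC.Census.BB.BB90.BZEnumZ09
import Summits.Ventures.QEC.Census.BB.BB90.BZEnumZ10
import Summits.Ventures.QEC.Census.BB.BB90.BZEnumZ11
import Summits.Ventures.QEC.Census.BB.BB90.BZEnumZ12
import Summits.Ventures.QEC.Census.BB.BB90.BZEnumZ13
import Summits.Ventures.QEC.Census.BB.BB90.BZEnumZ14
import Summits.Ventures.QEC.Census.BB.BB90.BZEnumZ15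
import Summits.Ventures.QEC.Census.BB.BB90.BZEnumZ16
import Summits.Ventures.QEC.Census.BB.BB90.BZEnumZ17
import Summits.Ventures.QEC.Census.BB.BB90.BZEnumZ18
import Summits.Ventures.QEC.Census.BB.BB90.BZEnumZ19
import Summits.Ventures.QEC.Census.BB.BB90.BZEnumZ20
import Summits.Ventures.QEC.Census.BB.BB90.BZEnumZ21
import Summits.Ventures.QEC.Census.BB.BB90.BZEnumZ22
import Summits.Ventures.QEC.Census.BB.BB90.BZEnumZ23
import Summits.Ventures.QEC.Census.BB.BB90.BZEnumZ24
import Summits.Ventures.QEC.Census.BB.BB90.BZEnumZ25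
import Summits.Ventures.QEC.Census.BB.BB90.BZEnumZ26
import Summits.Ventures.QEC.Census.BB.BB90.BZEnumZ27
import Summits.Ventures.QEC.Census.BB.BB90.BZEnumZ28
import Summits.Ventures.QEC.Census.BB.BB90.BZEnumZ29
import Summits.Ventures.QEC.Census.BB.BB90.BZEnumZ30
import Summits.Ventures.QEC.Census.BB.BB90.BZEnumZ31
import Summits.Ventures.QEC.Census.BB.BB90.BZEnumZ32
import Summits.Ventures.QEC.Census.BB.BB90.BZEnumZ33
import Summits.Ventures.QEC.Census.BB.BB90.BZEnumZ34
import Summits.Ventures.QEC.Theorems.BB90DistanceCertificateWeightTenZLogical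
import Summits.Ventures.QEC.Theses.BB90DistanceCertificate
import HarnessLib

/-!
# Route BB90DistanceCertificate, item NoZLogicalBelowTen (stmt-Ventures-19781): every `Z`-logical of `BB.bb90`
# (`[[90,8,10]]`) has weight `≥ 10` — tier KERNEL (CERTIFIED)

Method `bz` (Brouwer–Zimmermann, kernel-A certificate `cert/BB90.certA.json` `a5d2f23c…`): the 17 blocks of the `Z` side
are assembled from qec-search-7's KERNEL verdict files — per block two information-set facts `sysZ_b_i`, two
enumeration verdicts `enumZ_b_i` (`decide +kernel`, chunked), the relative-rank bound `boundZ_b` — by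
`DistCert.bzZBlock_of_parts` (`Census/CertBZInfoSets.lean`); with the structural check `bzZStruct_ok` and the
row-count check `bzZLen_ok` (search-7, `BZStructZ.lean`) and the allow-list check (here, `decide +kernel`), type-10's
`bz_lower_sound` (`Census/CertCheckBZSound.lean`, on type-07's `BZAssembly` and type-02's `RankCert`) gives
`9 < |w|` for every non-trivial flat `Z`-logical of the certificate's code, transported to `BB.bb90` by type-05's
`BB.Code.zLowerBound_of_flat` through the index identity of the weight-10 witness closer. Axioms standard throughout.
-/

namespace Summit.Ventures.QEC.Census.BB90

open Matrix Literature.InformationTheory.QuantumCodes Literature.InformationTheory.QuantumCodes.BB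

/-- The `Z` allow-list of the `BB90` certificate (45 low-weight stabilizers) decomposes over the rows of `H^Z`
(kernel `decide`). -/
theorem foundZ_ok90 : foundOK BB90.cert.HZ BB90.cert.sideZ.found = true := by
  decide +kernel

/-- One block from its five parts (2 information-set facts, 2 enumeration verdicts, 1 bound). -/
theorem blockZ_ok (b : ℕ) {blk : BZBlock} (hb : bzData.sideZ.blocks[b]? = some blk) (hm : blk.mats.length = 2)
    (hs0 : cert.bzZSys bzData b 0 = true) (hs1 : cert.bzZSys bzData b 1 = true)
    (he0 : cert.bzZEnum bzData b 0 = true) (he1 : cert.bzZEnum bzData b 1 = true)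
    (hbd : cert.bzZBound bzData b = true) : cert.bzZBlock bzData b = true :=
  cert.bzZBlock_of_parts bzData hb hm
    (fun i hi => by interval_cases i <;> assumption) (fun i hi => by interval_cases i <;> assumption) hbd

/-- **All 17 `Z` blocks replay** (from the 34 + 34 + 17 emitted KERNEL part theorems). -/
theorem blocks_ok : ∀ b : ℕ, b < bzData.sideZ.blocks.length → cert.bzZBlock bzData b = true := by
  intro b hb
  change b < 17 at hb
  interval_cases b
  · exact blockZ_ok 0 (blk := bzBlockZ0) rfl rfl sysZ_0_0 sysZ_0_1 enumZ_0_0 enumZ_0_1 boundZ_0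
  · exact blockZ_ok 1 (blk := bzBlockZ1) rfl rfl sysZ_1_0 sysZ_1_1 enumZ_1_0 enumZ_1_1 boundZ_1
  · exact blockZ_ok 2 (blk := bzBlockZ2) rfl rfl sysZ_2_0 sysZ_2_1 enumZ_2_0 enumZ_2_1 boundZ_2
  · exact blockZ_ok 3 (blk := bzBlockZ3) rfl rfl sysZ_3_0 sysZ_3_1 enumZ_3_0 enumZ_3_1 boundZ_3
  · exact blockZ_ok 4 (blk := bzBlockZ4) rfl rfl sysZ_4_0 sysZ_4_1 enumZ_4_0 enumZ_4_1 boundZ_4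
  · exact blockZ_ok 5 (blk := bzBlockZ5) rfl rfl sysZ_5_0 sysZ_5_1 enumZ_5_0 enumZ_5_1 boundZ_5
  · exact blockZ_ok 6 (blk := bzBlockZ6) rfl rfl sysZ_6_0 sysZ_6_1 enumZ_6_0 enumZ_6_1 boundZ_6
  · exact blockZ_ok 7 (blk := bzBlockZ7) rfl rfl sysZ_7_0 sysZ_7_1 enumZ_7_0 enumZ_7_1 boundZ_7
  · exact blockZ_ok 8 (blk := bzBlockZ8) rfl rfl sysZ_8_0 sysZ_8_1 enumZ_8_0 enumZ_8_1 boundZ_8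
  · exact blockZ_ok 9 (blk := bzBlockZ9) rfl rfl sysZ_9_0 sysZ_9_1 enumZ_9_0 enumZ_9_1 boundZ_9
  · exact blockZ_ok 10 (blk := bzBlockZ10) rfl rfl sysZ_10_0 sysZ_10_1 enumZ_10_0 enumZ_10_1 boundZ_10
  · exact blockZ_ok 11 (blk := bzBlockZ11) rfl rfl sysZ_11_0 sysZ_11_1 enumZ_11_0 enumZ_11_1 boundZ_11
  · exact blockZ_ok 12 (blk := bzBlockZ12) rfl rfl sysZ_12_0 sysZ_12_1 enumZ_12_0 enumZ_12_1 boundZ_12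
  · exact blockZ_ok 13 (blk := bzBlockZ13) rfl rfl sysZ_13_0 sysZ_13_1 enumZ_13_0 enumZ_13_1 boundZ_13
  · exact blockZ_ok 14 (blk := bzBlockZ14) rfl rfl sysZ_14_0 sysZ_14_1 enumZ_14_0 enumZ_14_1 boundZ_14
  · exact blockZ_ok 15 (blk := bzBlockZ15) rfl rfl sysZ_15_0 sysZ_15_1 enumZ_15_0 enumZ_15_1 boundZ_15
  · exact blockZ_ok 16 (blk := bzBlockZ16) rfl rfl sysZ_16_0 sysZ_16_1 enumZ_16_0 enumZ_16_1 boundZ_16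

/-- **The flat lower bound**: every non-trivial `Z`-logical of the certificate's code has weight `≥ 10`. -/
theorem ten_le (w : Fin cert.n → ZMod 2) (hw : rowMatrix cert.n cert.HX *ᵥ w = 0)
    (hw' : w ∉ rowSpace (rowMatrix cert.n cert.HZ)) : 10 ≤ hammingNorm w := by
  have h := bz_lower_sound comm_flat90 foundZ_ok90 bzZStruct_ok bzZLen_ok blocks_ok w hw hw'
  change 10 - 1 < hammingNorm w at h
  omega

/-- **Item NoZLogicalBelowTen, PROVED** (tier KERNEL): every `Z`-type logical operator of `BB.bb90` has Hamming
weight `≥ 10`. -/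
theorem noZLogicalBelowTen_proof : Summit.Ventures.QEC.Theses.BB90DistanceCertificate.NoZLogicalBelowTen :=
  BB.bb90.zLowerBound_of_flat
    (D := CSSCode.ofMatrices (rowMatrix cert.n cert.HX) (rowMatrix cert.n cert.HZ) comm_flat90)
    HX_eq_flat HZ_eq_flat ten_le

end Summit.Ventures.QEC.Census.BB90
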